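import Summits.QuantumFields.YangMills.Theorems.UnitScaleTiltProp8FlatMinimizerH
import Summits.QuantumFields.YangMills.Theorems.UnitScaleTiltProp8FlatPropagatorGradGlobal
import Literature.MathematicalPhysics.QuantumFieldTheory.Balaban1983to89.B6SectAOntoV1
import HarnessLib

/-!
# Route `UnitScaleTilt`, crux K1 child «MinimiserStabilityRegPr» (stmt-QuantumFields-19200), leaf V2′ `stub_halvingStep` — PILLAR F3
# (flat-operator bridge), LETTER ASK (a) OF THE F4 PEN (fleet bus 2026-08-27T10:08:46Z): **THE FLAT `H` AND `G` OF PILLAR F3 AS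
# REAL-LINEAR OPERATORS** — [Balaban1985Variational] (45)–(46) p. 285 («The operators Δ, Q and R define the operator H»), (53) p. 286 and
# (119) p. 295 (the contraction estimates use the LINEARITY of `H`, `G̃`), p. 288 («operators acting on the Lie algebra valued functions»)

Cell `ym3-torus` (HUMAN RULING D-0037, YM ladder rung R3), seat `ym3-torus-p1` gen 15.  `--supports stmt-QuantumFields-19200 --as helper`;
count-neutral; def-free.

WHY.  p1 g14's `FlatMinimizerH.exists_flatH(_T3)` (p518762) packages print's flat `H` ([Balaban1984PropagatorsI] (1.63) `H_k`, read back to the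
Setup torus as `H b := tV⁻¹(pullR(H_k · cplx(tB b)))`) as a BARE FUNCTION behind an `∃`, with the letters `Q_j(Hb) = b`, `|Hb| ≤ C·β`,
`L^j·|∇(Hb)| ≤ C·β`.  The F4 pen's junction `FlatScalarExtension.exists_extension_T3` (the 𝔤ᶜ-componentwise extension with the SAME letters) and
its `extension_rightInverse` consume a REAL-LINEAR `g : (PBond (F.P K) j₁ → ℝ) →ₗ[ℝ] (PBond (F.P K) 0 → ℝ)` and a LINEAR right inverse
`q ∘ g = id`; the contraction (53)/(119) uses linearity.  This file exports exactly that, WITHOUT a definition: the explicit formula of p518762 IS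
an `ℝ`-linear map (§1), so every landed letter about the formula (`FlatMinimizerH.abs_H_le`/`abs_grad_H_le`/`bondAvgIter_H_eq`,
`FlatMinimizerHLandau.RE_dsE_H_eq_zero`/`curlAction_H_le`, `FlatMinimizerHDecay.abs_H_le_sum`/`abs_grad_H_le_sum`) transfers to the linear map by
`rw`; §2 packages the two letters and the right inverse `bondAvgIterLin P ℝ j ∘ₗ H = id` (lit-balaban `B6SectAOntoV1.bondAvgIterLin`); §3 is the
d = 3 carrier form in the hypothesis shape of `exists_extension_T3` (`hg₀`, `hg₁` verbatim); §4 does the same for the one-level V1 propagator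
`G = GE (twoScale (K−n) … ∅)` of `FlatPropagatorGradGlobal.exists_GE_sup_grad_lap_T3` (already `→ₗ[ℝ]` on `EuclideanSpace`; here conjugated
to plain functions `PBond → ℝ` by `WithLp.toLp`/application, with its three sup-norm letters).

HONEST SCOPE.  (i) Linear algebra only; no estimate is re-proved (all letters are p1 g14's by name).  (ii) ONE LEVEL: these are the operators of
the pure small-field problem with the constraint at the single level `j = K − n` on the WHOLE torus — the operators that [Balaban1985Variational]
Sect. F (157)–(158) applies on the CUBE SEQUENCE (144) are the MULTI-LEVEL `H`, `G̃` of [Balaban1984PropagatorsII] ((2.130), Cor. 2.8) for the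
nested family `{□_j}` with its level-0 annulus; see the seat's located note (UV3-NODE §24).  (iii) NOT a claim about the mass gap.

References: T. Bałaban, CMP **102** (1985) 277–309 [Balaban1985Variational] (45)–(46) p.285, (53) p.286, (119) p.295, p.288; CMP **95** (1984) 17–40
[Balaban1984PropagatorsI] (1.63) p.28, (1.115) p.36.
-/

set_option autoImplicit false

noncomputable section

open scoped BigOperators Matrix

namespace Summit.QuantumFields.YangMills.Theorems.FlatMinimizerHLinear

open Literature.MathematicalPhysics.QuantumFieldTheory.Balaban1983to89
open Literature.MathematicalPhysics.QuantumFieldTheory.BalabanImbrieJaffe1984to88.BIJ85AxialPropagator411 (BondSpace)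
open LatticeFieldCalculus
open B5Eq117TorusCarriers (Mk tV tB)
open B5SectBStatements (Fld cplx)
open B5TowerOneStroke (pullR pullR_apply)
open B5Hk163Torus (HkOp)
open B5Hk163TorusHolderDecay (MD163)
open B5Hk163Decay (MG163 MG163_nonneg)
open B5Hk163Strip (kappa163 kappa163_pos)
open B4TorusKernel (periodConst)
open B5Kernel166Decay (periodConst_pos)
open B4Sect5Proof (latticeConst latticeConst_nonneg)
open B6SectAOntoV1 (bondAvgIterLin bondAvgIterLin_apply)
open B6SectCTwoScaleV1 (twoScale)
open B6SectAVectorModelV1 (GE)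
open FlatMinimizerH (bondAvgIter_H_eq abs_H_le abs_grad_H_le le_T3)

variable {P : Params} {j : ℕ}

/-! ## §1 The explicit `H` of p518762 is an `ℝ`-linear map -/

/-- `cplx ∘ tB` is additive. [cite: Balaban1984PropagatorsI, (1.17) p.20] -/
theorem cplx_tB_add (b₁ b₂ : VecField P j ℝ) : cplx (tB (b₁ + b₂)) = cplx (tB b₁) + cplx (tB b₂) := by
  funext i
  simp only [cplx, map_add, PiLp.add_apply, Complex.ofReal_add, Pi.add_apply]

/-- `cplx ∘ tB` is `ℝ`-homogeneous. [cite: Balaban1984PropagatorsI, (1.17) p.20] -/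
theorem cplx_tB_smul (r : ℝ) (b : VecField P j ℝ) : cplx (tB (r • b)) = (r : ℂ) • cplx (tB b) := by
  funext i
  simp only [cplx, map_smul, PiLp.smul_apply, smul_eq_mul, Complex.ofReal_mul, Pi.smul_apply]

/-- `pullR` is additive. [cite: Balaban1984PropagatorsI, (1.17) p.20] -/
theorem pullR_add {d : ℕ} (L : ℕ) (M : Fin d → ℕ) (k : ℕ) (X Y : B5Prop11Plancherel.Tor (B5Prop11Plancherel.fine (L ^ k) M) × Fin d → ℂ) :
    pullR L M k (X + Y) = pullR L M k X + pullR L M k Y := by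
  ext i
  simp only [pullR_apply, Pi.add_apply, Complex.add_re, PiLp.add_apply]

/-- `pullR` is `ℝ`-homogeneous. [cite: Balaban1984PropagatorsI, (1.17) p.20] -/
theorem pullR_smul {d : ℕ} (L : ℕ) (M : Fin d → ℕ) (k : ℕ) (r : ℝ) (X : B5Prop11Plancherel.Tor (B5Prop11Plancherel.fine (L ^ k) M) × Fin d → ℂ) :
    pullR L M k ((r : ℂ) • X) = r • pullR L M k X := by
  ext i
  simp only [pullR_apply, Pi.smul_apply, smul_eq_mul, Complex.re_ofReal_mul, PiLp.smul_apply]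

/-- **THE FLAT `H` IS LINEAR** (every `Params`, every level `j ≤ m + K`): there is an `ℝ`-linear map `H : VecField P j ℝ →ₗ[ℝ] VecField P 0 ℝ` EQUAL to
p1 g14's explicit `b ↦ tV⁻¹(pullR(H_k · cplx(tB b)))` — so every letter landed for the formula transfers by rewriting.
[cite: Balaban1985Variational, (45)-(46) p.285; Balaban1984PropagatorsI, (1.63) p.28] -/
theorem exists_linearMap_H_eq (hj : j ≤ P.m + P.K) :
    ∃ H : VecField P j ℝ →ₗ[ℝ] VecField P 0 ℝ,
      ∀ b, H b = (tV hj).symm (pullR P.L (Mk P j) j (HkOp (P.L ^ j) (Mk P j) *ᵥ cplx (tB b))) := by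
  refine ⟨{ toFun := fun b => (tV hj).symm (pullR P.L (Mk P j) j (HkOp (P.L ^ j) (Mk P j) *ᵥ cplx (tB b)))
            map_add' := fun b₁ b₂ => ?_
            map_smul' := fun r b => ?_ }, fun b => rfl⟩
  · rw [cplx_tB_add, Matrix.mulVec_add, pullR_add, map_add]
  · rw [cplx_tB_smul, Matrix.mulVec_smul, pullR_smul, map_smul, RingHom.id_apply]

/-! ## §2 The letters for the linear `H`, every `Params` (constant a function of `d` alone) -/

/-- **THE FLAT `H` AS A LINEAR OPERATOR WITH ITS LETTERS**, every `Params` with `P.d = d`, every `j ≤ m + K`: an `ℝ`-LINEAR `H` equal to the explicit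
formula, a LINEAR right inverse of the `j`-fold block average (`bondAvgIterLin P ℝ j ∘ₗ H = id`, i.e. (45) `Q_j(Hb) = b`), and the two letters (46)
`|Hb| ≤ C·β`, `L^j·|(Hb)(⟨s+e_ν,μ⟩) − (Hb)(⟨s,μ⟩)| ≤ C·β` for `|b| ≤ β`, `C = C(d) > 0`.
[cite: Balaban1985Variational, (45)-(46) p.285; Balaban1984PropagatorsI, (1.63) p.28, (1.115) p.36] -/
theorem exists_flatH_linear (d : ℕ) (hd : 1 ≤ d) : ∃ C : ℝ, 0 < C ∧ ∀ (P : Params), P.d = d → ∀ (j : ℕ) (hj : j ≤ P.m + P.K),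
    ∃ H : VecField P j ℝ →ₗ[ℝ] VecField P 0 ℝ,
      (∀ b, H b = (tV hj).symm (pullR P.L (Mk P j) j (HkOp (P.L ^ j) (Mk P j) *ᵥ cplx (tB b)))) ∧
      bondAvgIterLin P ℝ j ∘ₗ H = LinearMap.id ∧
      ∀ (b : VecField P j ℝ) (β : ℝ), (∀ c', |b c'| ≤ β) →
        (∀ c : PBond P 0, |H b c| ≤ C * β) ∧
        (∀ (s : Site P 0) (μ ν : Fin P.d), (P.L : ℝ) ^ j * |H b ⟨s.shift ν, μ⟩ - H b ⟨s, μ⟩| ≤ C * β) := by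
  have _h := hd
  refine ⟨max (MG163 d * periodConst (kappa163 d) (d - 1) * (d * latticeConst d (kappa163 d / d)))
      (MD163 d * periodConst (kappa163 d) (d - 1) * (d * latticeConst d (kappa163 d / d))) + 1,
    add_pos_of_nonneg_of_pos (le_max_of_le_left (mul_nonneg (mul_nonneg (MG163_nonneg _) (periodConst_pos (kappa163_pos _) _).le)
      (mul_nonneg (Nat.cast_nonneg _) (latticeConst_nonneg _ (div_nonneg (kappa163_pos _).le (Nat.cast_nonneg _)))))) one_pos,
    fun P hPd j hj => ?_⟩
  subst hPd
  obtain ⟨H, hH⟩ := exists_linearMap_H_eq (P := P) hj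
  refine ⟨H, hH, ?_, fun b β hb => ?_⟩
  · apply LinearMap.ext
    intro b
    rw [LinearMap.comp_apply, bondAvgIterLin_apply, hH, bondAvgIter_H_eq, LinearMap.id_apply]
  · have hβ : 0 ≤ β := by
      obtain ⟨c⟩ : Nonempty (PBond P j) := ⟨⟨fun _ => 0, ⟨0, P.hd⟩⟩⟩
      exact (abs_nonneg _).trans (hb c)
    refine ⟨fun c => ?_, fun s μ ν => ?_⟩
    · rw [hH]
      exact (abs_H_le hj b hb c).trans (mul_le_mul_of_nonneg_right ((le_max_left _ _).trans (le_add_of_nonneg_right zero_le_one)) hβ)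
    · rw [hH]
      exact (abs_grad_H_le hj b hb s μ ν).trans (mul_le_mul_of_nonneg_right ((le_max_right _ _).trans (le_add_of_nonneg_right zero_le_one)) hβ)

/-! ## §3 At the d = 3 carrier, in the hypothesis shape of `FlatScalarExtension.exists_extension_T3` -/

section T3

open T3ContinuumYM3Torus (T3Family)
open Prop7FlatCoercivityR (succ_le_T3)

/-- **THE FLAT `H` AT THE d = 3 CARRIER AS A REAL-LINEAR OPERATOR** (`j₁ = K − n`): an ABSOLUTE `C > 0` and, for every member `F`, heights `n, K`, an
`ℝ`-linear `H : (PBond (F.P K) (K−n) → ℝ) →ₗ[ℝ] (PBond (F.P K) 0 → ℝ)` equal to p1 g14's formula, with the linear right inverse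
`bondAvgIterLin ∘ₗ H = id` ((45) `Q(HB) = B`) and the two letters in the verbatim shape of the hypotheses `hg₀`, `hg₁` of
`FlatScalarExtension.exists_extension_T3` (`C₀ = C₁ = C`). [cite: Balaban1985Variational, (45)-(46) p.285, Sect. F (161) p.302] -/
theorem exists_flatH_linear_T3 : ∃ C : ℝ, 0 < C ∧ ∀ (F : T3Family) (n K : ℕ),
    ∃ H : (PBond (F.P K) (K - n) → ℝ) →ₗ[ℝ] (PBond (F.P K) 0 → ℝ),
      (∀ b, H b = (tV (le_T3 F n K)).symm
        (pullR (F.P K).L (Mk (F.P K) (K - n)) (K - n) (HkOp ((F.P K).L ^ (K - n)) (Mk (F.P K) (K - n)) *ᵥ cplx (tB b)))) ∧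
      bondAvgIterLin (F.P K) ℝ (K - n) ∘ₗ H = LinearMap.id ∧
      (∀ (x : PBond (F.P K) (K - n) → ℝ) (β : ℝ), (∀ c', |x c'| ≤ β) → ∀ b, |H x b| ≤ C * β) ∧
      (∀ (x : PBond (F.P K) (K - n) → ℝ) (β : ℝ), (∀ c', |x c'| ≤ β) →
        ∀ (s : Site (F.P K) 0) (μ ν : Fin 3), (F.L : ℝ) ^ (K - n) * |H x ⟨s.shift ν, μ⟩ - H x ⟨s, μ⟩| ≤ C * β) := by
  obtain ⟨C, hC, h⟩ := exists_flatH_linear 3 (by norm_num)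
  refine ⟨C, hC, fun F n K => ?_⟩
  obtain ⟨H, hH, hQ, hL⟩ := h (F.P K) rfl (K - n) (le_T3 F n K)
  exact ⟨H, hH, hQ, fun x β hx b => (hL x β hx).1 b, fun x β hx s μ ν => (hL x β hx).2 s μ ν⟩

/-! ## §4 The one-level V1 propagator `G` at the d = 3 carrier as a real-linear operator on plain bond functions -/

/-- **THE ONE-LEVEL FLAT `G` AT THE d = 3 CARRIER AS A REAL-LINEAR OPERATOR ON `PBond → ℝ`** (odd `L > 1`, weight `a·(L^{K−n})³`, `a > 0`): a constant
`C = C(L, a) > 0` and, for every member with `F.L = L` and heights `n < K`, an `ℝ`-linear `G : (PBond (F.P K) 0 → ℝ) →ₗ[ℝ] (PBond (F.P K) 0 → ℝ)` which IS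
`FlatPropagatorGradGlobal`'s `GE (twoScale (K−n) … ∅)` read on plain functions (`G x b = (GE … (toLp x)) b`), with its three sup-norm letters
(`|Gx| ≤ C·B`, `L^{K−n}·|∇_ν(Gx)| ≤ C·B`, `(L^{K−n})²·|Δ(Gx)| ≤ C·B` for `|x| ≤ B`) — the shape `hg₀`/`hg₁` of `FlatScalarExtension.exists_extension_T3`
at `j₁ = 0`. [cite: Balaban1984PropagatorsI, (1.115) p.36; Balaban1985Variational, (165) p.304] -/
theorem exists_flatG_linear_T3 (L : ℕ) (hL : Odd L ∧ 1 < L) {a : ℝ} (ha : 0 < a) :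
    ∃ C : ℝ, 0 < C ∧ ∀ (F : T3Family), F.L = L → ∀ (n K : ℕ), n < K →
      ∃ G : (PBond (F.P K) 0 → ℝ) →ₗ[ℝ] (PBond (F.P K) 0 → ℝ),
        (∀ (x : PBond (F.P K) 0 → ℝ) (b : PBond (F.P K) 0),
          G x b = GE (twoScale (K - n) (succ_le_T3 F n K) (∅ : Finset (Site (F.P K) (K - n + 1)))) (c := ((F.L : ℝ)) ^ (K - n))
            (pow_ne_zero (K - n) (Nat.cast_ne_zero.2 (F.P K).L_pos.ne'))
            (w := fun _ => a * ((F.L : ℝ) ^ (K - n)) ^ 3) (fun _ => mul_pos ha (pow_pos (pow_pos (Nat.cast_pos.2 (F.P K).L_pos) _) _))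
            (WithLp.toLp 2 x) b) ∧
        (∀ (x : PBond (F.P K) 0 → ℝ) (B : ℝ), (∀ b', |x b'| ≤ B) → ∀ b, |G x b| ≤ C * B) ∧
        (∀ (x : PBond (F.P K) 0 → ℝ) (B : ℝ), (∀ b', |x b'| ≤ B) →
          ∀ (s : Site (F.P K) 0) (μ ν : Fin 3), (F.L : ℝ) ^ (K - n) * |G x ⟨s.shift ν, μ⟩ - G x ⟨s, μ⟩| ≤ C * B) ∧
        (∀ (x : PBond (F.P K) 0 → ℝ) (B : ℝ), (∀ b', |x b'| ≤ B) →
          ∀ (s : Site (F.P K) 0) (μ : Fin 3), ((F.L : ℝ) ^ (K - n)) ^ 2 *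
            |∑ ν : Fin 3, ((G x ⟨s, μ⟩ - G x ⟨s.shift ν, μ⟩) + (G x ⟨s, μ⟩ - G x ⟨s.unshift ν, μ⟩))| ≤ C * B) := by
  obtain ⟨C, hC, h⟩ := FlatPropagatorGradGlobal.exists_GE_sup_grad_lap_T3 L hL ha
  refine ⟨C, hC, fun F hFL n K hnK => ?_⟩
  have hw : ∀ _i : B6SectAOperatorsV1.BondIdx (twoScale (K - n) (succ_le_T3 F n K) (∅ : Finset (Site (F.P K) (K - n + 1)))),
      0 < a * ((F.L : ℝ) ^ (K - n)) ^ 3 := fun _ => mul_pos ha (pow_pos (pow_pos (Nat.cast_pos.2 (F.P K).L_pos) _) _)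
  set G₀ := GE (twoScale (K - n) (succ_le_T3 F n K) (∅ : Finset (Site (F.P K) (K - n + 1)))) (c := ((F.L : ℝ)) ^ (K - n))
    (pow_ne_zero (K - n) (Nat.cast_ne_zero.2 (F.P K).L_pos.ne')) (w := fun _ => a * ((F.L : ℝ) ^ (K - n)) ^ 3) hw with hG₀
  refine ⟨(WithLp.linearEquiv 2 ℝ (PBond (F.P K) 0 → ℝ)).toLinearMap ∘ₗ G₀ ∘ₗ
      (WithLp.linearEquiv 2 ℝ (PBond (F.P K) 0 → ℝ)).symm.toLinearMap, fun x b => rfl, ?_, ?_, ?_⟩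
  · intro x B hxB b
    exact (h F hFL n K hnK _ hw (fun _ => rfl) (WithLp.toLp 2 x) B hxB).1 b
  · intro x B hxB s μ ν
    exact (h F hFL n K hnK _ hw (fun _ => rfl) (WithLp.toLp 2 x) B hxB).2.1 s μ ν
  · intro x B hxB s μ
    exact (h F hFL n K hnK _ hw (fun _ => rfl) (WithLp.toLp 2 x) B hxB).2.2 s μ

end T3

end Summit.QuantumFields.YangMills.Theorems.FlatMinimizerHLinear

end
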